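import Literature.AlgebraicGeometry.HodgeTheory.SupportedHodgeClassesAlgebraic
import Literature.AlgebraicGeometry.HodgeTheory.GysinKernelProofs
import Literature.AlgebraicGeometry.Motives.ComplexPointsOrientation
import Literature.AlgebraicGeometry.Resolution.ProjectiveResolutionProofs
import Literature.AlgebraicTopology.SingularHomology.GysinMapSupportProofs
import Summits.HodgeConjecture.HodgeConjecture.Theses.NoetherLefschetzOneUp

/-!
# Route NoetherLefschetzOneUp — `VerticalHodgeAlgebraic` (support item stmt-HodgeConjecture-11603)

The support item `VerticalHodgeAlgebraic` of the route
`Summits/HodgeConjecture/HodgeConjecture/Theses/NoetherLefschetzOneUp`: *for `X` smooth projective of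
dimension `4` over `ℂ` and `f : X ⟶ ℙ²` surjective, the span of the rational `(2,2)`-classes
`c ∈ H⁴(X(ℂ); ℂ)` vanishing on `(X ∖ f⁻¹T)(ℂ)` for some Zariski-closed `T ⊊ ℙ²` (VERTICAL classes) lies
in `algebraicClasses X 2`.*

Proof (the item's own sketch, = C. Voisin, Ann. Sci. ÉNS 46 (2013), proof of Lemma 2.1 with `k = 2`,
which the tree proves from its named facts in `HodgeTheory/SupportedHodgeClassesAlgebraic`):

1. (unconditional, `span_vertical_le_supportedClasses_one`) a class dying off `f⁻¹T`, `T ⊊ ℙ²`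
   closed, is supported in codimension `≥ 1`: `f⁻¹T` is closed, and proper because `f` is onto, so
   all its points have codimension `≥ 1` in the irreducible `X`
   (`one_le_coheight_of_mem_of_isClosed`); hence the vertical span lies in `N¹H⁴ = supportedClasses X 4 1`.
2. (`mem_algebraicClasses_of_mem_supportedClasses_of_isOfHodgeType`, `p = 1`) a rational
   `(2,2)`-class in `N¹H⁴` is in `N²H⁴ = algebraicClasses X 2`: `ker (H⁴(X) → H⁴(X ∖ Z))` is the
   sum of the Gysin images of `H^{2d_j}(Ỹ_j)`, `Ỹ_j → Z_j` resolutions of the components of `Z`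
   (Deligne, Hodge III, Cor. 8.2.8), a Hodge class in it lifts to Hodge classes on the `Ỹ_j`
   (semisimplicity of polarisable Hodge structures, Voisin 2025 Cor. 2.12), those have `d_j ≤ 1`
   and are divisor classes (Lefschetz `(1,1)`), and Gysin images of algebraic classes are algebraic.

What is PROVED in the tree and fed here: projective Hironaka
(`Resolution.Hironaka1964_projective_holds`), the support property of Gysin maps over a field
(`gysinMap_restrictCompl_eq_zero_of_field ℂ`), Poincaré duality for `X(ℂ)` and the existence of
orientations (`OrientationFamily.hasPoincareDuality`, `Motives.ComplexPoints.isOrientableOver`).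
What remains NAMED FACTS of the tree (hypotheses of `verticalHodgeAlgebraic_of`, making it
CONDITIONAL): `Deligne1974_ker_restrictCompl_eq_iSup_range_complexGysin` (Hodge III Cor. 8.2.8; open
child Prop. 8.2.7, `GysinKernelSplit`), `Voisin2025_hodgeClass_lift_complexGysin` (Cor. 2.12; open
child the Hodge–Riemann polarizability, `HodgeRiemannPolarizability`), `lefschetzOneOne_rational`
(Voisin I Thm. 11.30; this route's own item `LefschetzOneOne`). The reduction of the item to the
single Literature-shaped statement "rational `(2,2)`-classes in `N¹H⁴` of a smooth projective
fourfold are algebraic" is recorded unconditionally (`verticalHodgeAlgebraic_of_supported`).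
-/

noncomputable section

open CategoryTheory AlgebraicGeometry
open Literature.AlgebraicGeometry Literature.AlgebraicGeometry.HodgeTheory
open Literature.AlgebraicTopology.SingularHomology

namespace Summit.HodgeConjecture.HodgeConjecture.Theorems

/-- **Vertical classes are supported in codimension `≥ 1`** (unconditional). For `X` smooth
projective of dimension `n` over `ℂ`, any `ℂ`-scheme `Y` and a morphism `f : X ⟶ Y` surjective on
points, the span of the classes `c ∈ Hⁱ(X(ℂ); ℂ)` (subject to any further condition `P`) vanishing
on `(X ∖ f⁻¹T)(ℂ)` for some Zariski-closed `T ≠ Y` lies in `N¹Hⁱ(X(ℂ); ℂ) = supportedClasses X i 1`: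
`f⁻¹T` is closed, proper (`f` is onto and `T ≠ Y`), hence all of its points have codimension `≥ 1`
in the irreducible `X`. [cite: GrothendieckTopology1969, §1] -/
theorem span_vertical_le_supportedClasses_one {n : ℕ} {X Y : Motives.SchemeOver ℂ}
    (hX : Motives.IsSmoothProjective n X) (f : X ⟶ Y) (hf : Function.Surjective f.left.base)
    (i : ℕ) (P : complexBetti X i → Prop) :
    Submodule.span ℂ {c : complexBetti X i | P c ∧ ∃ T : Set Y.left, IsClosed T ∧ T ≠ Set.univ ∧
        complexBetti.restrictCompl X (f.left.base ⁻¹' T) i c = 0} ≤ supportedClasses X i 1 := by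
  rw [Submodule.span_le]
  rintro c ⟨-, T, hT, hTne, h0⟩
  -- `f⁻¹T` is a proper closed subset of `X`
  have hZ : IsClosed (f.left.base ⁻¹' T) := hT.preimage f.left.continuous
  have hZne : f.left.base ⁻¹' T ≠ Set.univ := by
    intro h
    refine hTne (Set.eq_univ_of_forall fun y ↦ ?_)
    obtain ⟨x, rfl⟩ := hf y
    exact (h ▸ Set.mem_univ x : x ∈ f.left.base ⁻¹' T)
  exact mem_supportedClasses_of_restrictCompl_eq_zero hZ
    (fun z hz ↦ by exact_mod_cast one_le_coheight_of_mem_of_isClosed hX hZ hZne hz) h0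

/-- **Reduction of the item to a Literature-shaped statement** (unconditional):
`VerticalHodgeAlgebraic` follows from "on every smooth projective complex fourfold, a rational
`(2,2)`-class supported in codimension `≥ 1` (`∈ N¹H⁴ = supportedClasses X 4 1`) is algebraic
(`∈ N²H⁴ = algebraicClasses X 2`)" — the `(n, p) = (4, 1)` slice of Voisin 2013, Lemma 2.1 — by
`span_vertical_le_supportedClasses_one`. [cite: Voisin2013GHCBloch, Lemma 2.1] -/
theorem verticalHodgeAlgebraic_of_supported
    (h : ∀ ⦃X : Motives.SchemeOver ℂ⦄, Motives.IsSmoothProjective 4 X →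
      ∀ c : complexBetti X (2 * 2), c ∈ supportedClasses X (2 * 2) 1 → IsRationalClass c →
        IsOfHodgeType 4 X (2 * 2) 2 2 c → c ∈ algebraicClasses X 2) :
    Summit.HodgeConjecture.HodgeConjecture.Theses.NoetherLefschetzOneUp.VerticalHodgeAlgebraic := by
  unfold Summit.HodgeConjecture.HodgeConjecture.Theses.NoetherLefschetzOneUp.VerticalHodgeAlgebraic
  intro X f hX hf
  rw [Submodule.span_le]
  rintro c ⟨hc, hc', hT⟩
  have hcs : c ∈ supportedClasses X (2 * 2) 1 :=
    span_vertical_le_supportedClasses_one hX f hf (2 * 2)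
      (fun c ↦ IsRationalClass c ∧ IsOfHodgeType 4 X (2 * 2) 2 2 c)
      (Submodule.subset_span ⟨⟨hc, hc'⟩, hT⟩)
  exact h hX c hcs hc hc'

/-- **`VerticalHodgeAlgebraic` (item stmt-HodgeConjecture-11603), CONDITIONAL on three named facts
of the tree**: Deligne, *Hodge III*, Cor. 8.2.8 (`hA`), the lifting of Hodge classes along sums of
Gysin morphisms = semisimplicity of polarisable Hodge structures, Voisin 2025 Cor. 2.12 (`hB`), and
Lefschetz's theorem on `(1,1)`-classes in rational form, Voisin I Thm. 11.30 (`hL`). Vertical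
rational `(2,2)`-classes are supported in codimension `≥ 1` (`verticalHodgeAlgebraic_of_supported`)
and rational `(2,2)`-classes in `N¹H⁴` of a smooth projective fourfold are algebraic by Voisin
2013, proof of Lemma 2.1 (`mem_algebraicClasses_of_mem_supportedClasses_of_isOfHodgeType`, `p = 1`),
fed with the tree's theorems: projective Hironaka (`Hironaka1964_projective_holds`), the support
property of Gysin maps (`gysinMap_restrictCompl_eq_zero_of_field ℂ`) and Poincaré duality
(`OrientationFamily.hasPoincareDuality`, Hatcher Thm. 3.30 for the closed manifolds `X(ℂ)`) for the
orientation family chosen by `Motives.ComplexPoints.isOrientableOver` (`X(ℂ)` is `ℂ`-orientable).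
[cite: Voisin2013GHCBloch, Lemma 2.1 (proof)] [cite: DeligneHodgeIII1974, Cor. 8.2.8]
[cite: Voisin2025, Cor. 2.12] [cite: VoisinHodgeI2002, Thm. 11.30] -/
theorem verticalHodgeAlgebraic_of
    (hA : Deligne1974_ker_restrictCompl_eq_iSup_range_complexGysin)
    (hB : Voisin2025_hodgeClass_lift_complexGysin) (hL : lefschetzOneOne_rational) :
    Summit.HodgeConjecture.HodgeConjecture.Theses.NoetherLefschetzOneUp.VerticalHodgeAlgebraic := by
  refine verticalHodgeAlgebraic_of_supported fun X hX c hcs hc hc' ↦ ?_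
  -- an orientation family (complex points are orientable); every one has Poincaré duality
  let μ : OrientationFamily := fun _ _ h ↦ Classical.choice (Motives.ComplexPoints.isOrientableOver ℂ h)
  exact mem_algebraicClasses_of_mem_supportedClasses_of_isOfHodgeType hA hB
    (gysinMap_restrictCompl_eq_zero_of_field ℂ)
    Literature.AlgebraicGeometry.Resolution.Hironaka1964_projective_holds hL μ
    (OrientationFamily.hasPoincareDuality μ) hX 1 hcs hc hc'

/-- **`VerticalHodgeAlgebraic` within the route**: the Lefschetz `(1,1)` input is this route's own
support item `LefschetzOneOne` (stmt-HodgeConjecture-8544, verbatim the Literature named fact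
`lefschetzOneOne_rational`), so that inside the route `VerticalHodgeAlgebraic` costs exactly
`LefschetzOneOne` plus the two Hodge-theoretic named facts `hA` (Deligne, Hodge III Cor. 8.2.8) and
`hB` (Voisin 2025 Cor. 2.12). [cite: Voisin2013GHCBloch, Lemma 2.1 (proof)]
[cite: DeligneHodgeIII1974, Cor. 8.2.8] [cite: Voisin2025, Cor. 2.12] -/
theorem verticalHodgeAlgebraic_of_lefschetzOneOne
    (hA : Deligne1974_ker_restrictCompl_eq_iSup_range_complexGysin)
    (hB : Voisin2025_hodgeClass_lift_complexGysin)
    (hL : Summit.HodgeConjecture.HodgeConjecture.Theses.NoetherLefschetzOneUp.LefschetzOneOne) :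
    Summit.HodgeConjecture.HodgeConjecture.Theses.NoetherLefschetzOneUp.VerticalHodgeAlgebraic :=
  verticalHodgeAlgebraic_of hA hB fun _ _ hX c hc h11 ↦ hL hX c hc h11

end Summit.HodgeConjecture.HodgeConjecture.Theorems

end
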